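import Literature.Geometry.ComplexAnalytic.PhamBrieskornA3TwoBallDatum
import Mathlib.LinearAlgebra.Eigenspace.Basic
import HarnessLib

/-!
# The two-piece datum on the `τ² = −1` part of homology, for a self-map supported in two pieces that may also carry `τ²`-invariant classes

Topic `Literature/AlgebraicTopology/SingularHomology`; theorems only (no definition, no named fact), over `ℚ`. Written by the prover seat
`hodge-nonav-prover-Ax` (g18) for crux K1Q, stub S5 (`Summits/HodgeConjecture/HodgeConjecture/Theses/Q8SymplecticPowers.lean`). Sequel of
`HomologySelfMapTwoLocalPieces` (`h = id` off two disjoint open pieces ⇒ `h_* y − y ∈ im Hₙ(A₁) + im Hₙ(A₂)`) and of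
`PhamBrieskornA3TwoBallDatum` (whose pieces were modelled on `F°∕ι` on all of `Hₙ(A_k)`). In the quaternionic family the pieces
`A_k = X_s(ℂ) ∩ (ball at the d6 point)` also contain the two exceptional curves `E_±` (classes fixed by `τ²`, exchanged by the
monodromy), so the model identities hold only on the `τ|² = −1` part of `Hₙ(A_k)`; this file extracts the datum on
`W_k := im Hₙ(A_k) ∩ ker(τ_*² + 1)` from MODEL-FREE homological hypotheses on that part:
`τ|² a = −a ⇒ h|_* a = τ|_* a` on `A₁`, `τ|² a = −a ⇒ h|_* τ|_* a = a` on `A₂`, with `h τ = τ h`, `τ j τ = j`, `τ⁴ = id` pointwise.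

* **`twoPiecesKernelDatum`**: `W_k` is `τ_*`-stable with `τ_*² = −1`, `j_*` maps `W₁ → W₂ → W₁`, `h_* y − y ∈ W₁ + W₂` for `τ_*² y = −y`,
  `h_* = τ_*` on `W₁`, `h_* τ_* = 1` on `W₂`, `W_k ⊆ im Hₙ(A_k)`, and `dim W_k ≤ dim ker(τ|_*² + 1 on Hₙ(A_k))`.

## References

* [HatcherAT2002] A. Hatcher, Algebraic Topology, CUP 2002, §2.1 (functoriality), §2.2 (Mayer–Vietoris).
* [ArnoldGuseinzadeVarchenko2012] Arnold, Gusein-Zade, Varchenko, Singularities of Differentiable Maps II, Part I §1.1 (variation operator).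
-/

noncomputable section

open CategoryTheory Set ContinuousMap

namespace Literature.AlgebraicTopology.SingularHomology

namespace singularHomology

section Kernel

variable {X : Type} [TopologicalSpace X]

/-- `(τ|_A)_*` and `τ_*` are intertwined by `ι_*`. [cite: HatcherAT2002, §2.1] -/
theorem map_map_subsetIncl_restrictSelf {A : Set X} (τ : C(X, X)) (hτA : MapsTo τ A A) (n : ℕ) (a : singularHomology ℚ ℚ (↥A) n) :
    map ℚ ℚ τ n (map ℚ ℚ (subsetIncl A) n a) = map ℚ ℚ (subsetIncl A) n (map ℚ ℚ (restrictSelf τ hτA) n a) :=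
  map_map_subsetIncl_of_mapsTo ℚ τ hτA n a

/-- `τ_*⁴ = 1` on `Hₙ(X)` from `τ⁴ = id`. [cite: HatcherAT2002, §2.1] -/
theorem map_pow_four_apply (τ : C(X, X)) (hτ4 : ∀ x, τ (τ (τ (τ x))) = x) (n : ℕ) (y : singularHomology ℚ ℚ X n) :
    map ℚ ℚ τ n (map ℚ ℚ τ n (map ℚ ℚ τ n (map ℚ ℚ τ n y))) = y := by
  have h : τ.comp (τ.comp (τ.comp τ)) = ContinuousMap.id X := by ext x; exact hτ4 x
  have : map ℚ ℚ (τ.comp (τ.comp (τ.comp τ))) n y = y := by rw [h, map_id]; rfl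
  simpa only [map_comp, ModuleCat.comp_apply] using this

/-- **The two-piece datum on `ker(τ_*² + 1)`.** See the module docstring. [cite: HatcherAT2002, §2.1 and §2.2]
[cite: ArnoldGuseinzadeVarchenko2012, Part I §1.1] -/
theorem twoPiecesKernelDatum {A₁ A₂ B : Set X} (h1o : IsOpen A₁) (h2o : IsOpen A₂) (hBo : IsOpen B) (hcov : A₁ ∪ A₂ ∪ B = univ)
    (hdisj : Disjoint A₁ A₂) (h τ j : C(X, X)) (hB : ∀ x ∈ B, h x = x) (hhA₁ : MapsTo h A₁ A₁) (hhA₂ : MapsTo h A₂ A₂)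
    (hτA₁ : MapsTo τ A₁ A₁) (hτA₂ : MapsTo τ A₂ A₂) (hjA₁ : MapsTo j A₁ A₂) (hjA₂ : MapsTo j A₂ A₁)
    (hτ4 : ∀ x, τ (τ (τ (τ x))) = x) (hhτ : ∀ x, h (τ x) = τ (h x)) (hτjτ : ∀ x, τ (j (τ x)) = j x) (n : ℕ)
    [Module.Finite ℚ (singularHomology ℚ ℚ (↥A₁) n)] [Module.Finite ℚ (singularHomology ℚ ℚ (↥A₂) n)]
    (hloc₁ : ∀ a : singularHomology ℚ ℚ (↥A₁) n, map ℚ ℚ (restrictSelf τ hτA₁) n (map ℚ ℚ (restrictSelf τ hτA₁) n a) = -a →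
      map ℚ ℚ (restrictSelf h hhA₁) n a = map ℚ ℚ (restrictSelf τ hτA₁) n a)
    (hloc₂ : ∀ a : singularHomology ℚ ℚ (↥A₂) n, map ℚ ℚ (restrictSelf τ hτA₂) n (map ℚ ℚ (restrictSelf τ hτA₂) n a) = -a →
      map ℚ ℚ (restrictSelf h hhA₂) n (map ℚ ℚ (restrictSelf τ hτA₂) n a) = a) :
    let t : singularHomology ℚ ℚ X n →ₗ[ℚ] singularHomology ℚ ℚ X n := (map ℚ ℚ τ n).hom
    let W₁ : Submodule ℚ (singularHomology ℚ ℚ X n) := LinearMap.range (map ℚ ℚ (subsetIncl A₁) n).hom ⊓ Module.End.eigenspace (t ^ 2) (-1)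
    let W₂ : Submodule ℚ (singularHomology ℚ ℚ X n) := LinearMap.range (map ℚ ℚ (subsetIncl A₂) n).hom ⊓ Module.End.eigenspace (t ^ 2) (-1)
    (∀ w ∈ W₁, map ℚ ℚ τ n w ∈ W₁) ∧ (∀ w ∈ W₂, map ℚ ℚ τ n w ∈ W₂) ∧
    (∀ w ∈ W₁, map ℚ ℚ τ n (map ℚ ℚ τ n w) = -w) ∧ (∀ w ∈ W₂, map ℚ ℚ τ n (map ℚ ℚ τ n w) = -w) ∧
    (∀ w ∈ W₁, map ℚ ℚ j n w ∈ W₂) ∧ (∀ w ∈ W₂, map ℚ ℚ j n w ∈ W₁) ∧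
    (∀ y : singularHomology ℚ ℚ X n, map ℚ ℚ τ n (map ℚ ℚ τ n y) = -y → map ℚ ℚ h n y - y ∈ W₁ ⊔ W₂) ∧
    (∀ w ∈ W₁, map ℚ ℚ h n w = map ℚ ℚ τ n w) ∧ (∀ w ∈ W₂, map ℚ ℚ h n (map ℚ ℚ τ n w) = w) ∧
    W₁ ≤ LinearMap.range (map ℚ ℚ (subsetIncl A₁) n).hom ∧ W₂ ≤ LinearMap.range (map ℚ ℚ (subsetIncl A₂) n).hom ∧
    Module.finrank ℚ ↥W₁ ≤ Module.finrank ℚ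
      ↥(Module.End.eigenspace ((map ℚ ℚ (restrictSelf τ hτA₁) n).hom ^ 2) (-1 : ℚ)) ∧
    Module.finrank ℚ ↥W₂ ≤ Module.finrank ℚ
      ↥(Module.End.eigenspace ((map ℚ ℚ (restrictSelf τ hτA₂) n).hom ^ 2) (-1 : ℚ)) := by
  intro t W₁ W₂
  -- eigenspace membership unfolded
  have hmemE : ∀ w : singularHomology ℚ ℚ X n, w ∈ Module.End.eigenspace (t ^ 2) (-1 : ℚ) ↔ map ℚ ℚ τ n (map ℚ ℚ τ n w) = -w :=
    fun w => by rw [Module.End.mem_eigenspace_iff, pow_two, Module.End.mul_apply, neg_one_smul]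
  have hmemEA : ∀ {A : Set X} (hτA : MapsTo τ A A) (a : singularHomology ℚ ℚ (↥A) n),
      a ∈ Module.End.eigenspace ((map ℚ ℚ (restrictSelf τ hτA) n).hom ^ 2) (-1 : ℚ) ↔
        map ℚ ℚ (restrictSelf τ hτA) n (map ℚ ℚ (restrictSelf τ hτA) n a) = -a :=
    fun hτA a => by rw [Module.End.mem_eigenspace_iff, pow_two, Module.End.mul_apply, neg_one_smul]
  have ht4 : ∀ y : singularHomology ℚ ℚ X n, map ℚ ℚ τ n (map ℚ ℚ τ n (map ℚ ℚ τ n (map ℚ ℚ τ n y))) = y :=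
    map_pow_four_apply τ hτ4 n
  have hτ4A : ∀ {A : Set X} (hτA : MapsTo τ A A) (a : singularHomology ℚ ℚ (↥A) n),
      map ℚ ℚ (restrictSelf τ hτA) n (map ℚ ℚ (restrictSelf τ hτA) n (map ℚ ℚ (restrictSelf τ hτA) n
        (map ℚ ℚ (restrictSelf τ hτA) n a))) = a := fun hτA a => map_restrictSelf_pow_four ℚ τ hτA hτ4 n a
  -- `h_*` commutes with `τ_*`; `τ_*² j_* τ_*² = j_*`
  have hht : ∀ y : singularHomology ℚ ℚ X n, map ℚ ℚ h n (map ℚ ℚ τ n y) = map ℚ ℚ τ n (map ℚ ℚ h n y) := fun y => by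
    have hc : h.comp τ = τ.comp h := by ext x; exact hhτ x
    rw [← ModuleCat.comp_apply, ← map_comp, hc, map_comp, ModuleCat.comp_apply]
  have htjt : ∀ y : singularHomology ℚ ℚ X n, map ℚ ℚ τ n (map ℚ ℚ j n (map ℚ ℚ τ n y)) = map ℚ ℚ j n y := fun y => by
    have hc : (τ.comp j).comp τ = j := by ext x; exact hτjτ x
    rw [← ModuleCat.comp_apply, ← ModuleCat.comp_apply, ← map_comp, ← map_comp, hc]
  have ht2j : ∀ y : singularHomology ℚ ℚ X n, map ℚ ℚ τ n (map ℚ ℚ τ n y) = -y →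
      map ℚ ℚ τ n (map ℚ ℚ τ n (map ℚ ℚ j n y)) = -map ℚ ℚ j n y := fun y hy => by
    -- `τ j τ = j` at `τ y` and at `y`, with `τ² y = −y`
    have h1 : map ℚ ℚ j n (map ℚ ℚ τ n y) = -map ℚ ℚ τ n (map ℚ ℚ j n y) := by
      have h0 := htjt (map ℚ ℚ τ n y)
      rw [hy, map_neg, map_neg] at h0
      exact h0.symm
    have h2 := htjt y
    rw [h1, map_neg] at h2
    exact neg_eq_iff_eq_neg.mp h2
  -- the half-projector onto `ker(τ_*² + 1)` on a piece: `a' := a − τ|² a` satisfies `τ|² a' = −a'`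
  have hproj : ∀ {A : Set X} (hτA : MapsTo τ A A) (a : singularHomology ℚ ℚ (↥A) n),
      map ℚ ℚ (restrictSelf τ hτA) n (map ℚ ℚ (restrictSelf τ hτA) n
        (a - map ℚ ℚ (restrictSelf τ hτA) n (map ℚ ℚ (restrictSelf τ hτA) n a))) =
        -(a - map ℚ ℚ (restrictSelf τ hτA) n (map ℚ ℚ (restrictSelf τ hτA) n a)) := fun hτA a => by
    rw [map_sub, map_sub, hτ4A hτA, neg_sub]
  -- membership in `W_k` from a kernel element of the piece
  have hmemW : ∀ {A : Set X} (hτA : MapsTo τ A A) (a : singularHomology ℚ ℚ (↥A) n),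
      map ℚ ℚ (restrictSelf τ hτA) n (map ℚ ℚ (restrictSelf τ hτA) n a) = -a →
      map ℚ ℚ (subsetIncl A) n a ∈ LinearMap.range (map ℚ ℚ (subsetIncl A) n).hom ⊓ Module.End.eigenspace (t ^ 2) (-1 : ℚ) :=
    fun {A} hτA a ha => Submodule.mem_inf.2 ⟨⟨a, rfl⟩, (hmemE _).2 (by
      rw [map_map_subsetIncl_restrictSelf τ hτA, map_map_subsetIncl_restrictSelf τ hτA, ha, map_neg])⟩
  -- every element of `W_k` is `ι_* a'` with `τ|² a' = −a'`
  have hrep : ∀ {A : Set X} (hτA : MapsTo τ A A) (w : singularHomology ℚ ℚ X n),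
      w ∈ LinearMap.range (map ℚ ℚ (subsetIncl A) n).hom ⊓ Module.End.eigenspace (t ^ 2) (-1 : ℚ) →
      ∃ a : singularHomology ℚ ℚ (↥A) n, map ℚ ℚ (restrictSelf τ hτA) n (map ℚ ℚ (restrictSelf τ hτA) n a) = -a ∧
        map ℚ ℚ (subsetIncl A) n a = w := by
    intro A hτA w hw'
    obtain ⟨⟨a, rfl⟩, hw2⟩ := Submodule.mem_inf.1 hw'
    have hw := (hmemE _).1 hw2
    refine ⟨(1 / 2 : ℚ) • (a - map ℚ ℚ (restrictSelf τ hτA) n (map ℚ ℚ (restrictSelf τ hτA) n a)), ?_, ?_⟩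
    · rw [map_smul, map_smul, hproj hτA, smul_neg]
    · change map ℚ ℚ (subsetIncl A) n _ = map ℚ ℚ (subsetIncl A) n a
      rw [map_smul, map_sub, ← map_map_subsetIncl_restrictSelf τ hτA, ← map_map_subsetIncl_restrictSelf τ hτA]
      change (1 / 2 : ℚ) • (map ℚ ℚ (subsetIncl A) n a - map ℚ ℚ τ n (map ℚ ℚ τ n ((map ℚ ℚ (subsetIncl A) n).hom a))) = _
      rw [hw]
      change (1 / 2 : ℚ) • (map ℚ ℚ (subsetIncl A) n a - -map ℚ ℚ (subsetIncl A) n a) = map ℚ ℚ (subsetIncl A) n a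
      rw [sub_neg_eq_add, ← two_smul ℚ, smul_smul]; norm_num
  refine ⟨?_, ?_, fun w hw => (hmemE w).1 hw.2, fun w hw => (hmemE w).1 hw.2, ?_, ?_, ?_, ?_, ?_, fun w hw => hw.1, fun w hw => hw.1, ?_, ?_⟩
  · -- `τ_* W₁ ⊆ W₁`
    intro w hw
    obtain ⟨a, ha, rfl⟩ := hrep hτA₁ w hw
    rw [map_map_subsetIncl_restrictSelf τ hτA₁]
    refine hmemW hτA₁ _ ?_
    rw [ha, map_neg]
  · intro w hw
    obtain ⟨a, ha, rfl⟩ := hrep hτA₂ w hw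
    rw [map_map_subsetIncl_restrictSelf τ hτA₂]
    refine hmemW hτA₂ _ ?_
    rw [ha, map_neg]
  · -- `j_* W₁ ⊆ W₂`
    intro w hw
    exact Submodule.mem_inf.2 ⟨map_mem_range_of_mapsTo ℚ j hjA₁ n w hw.1, (hmemE _).2 (ht2j w ((hmemE w).1 hw.2))⟩
  · intro w hw
    exact Submodule.mem_inf.2 ⟨map_mem_range_of_mapsTo ℚ j hjA₂ n w hw.1, (hmemE _).2 (ht2j w ((hmemE w).1 hw.2))⟩
  · -- the variation on `ker(τ_*² + 1)`
    intro y hy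
    have hv := map_sub_self_mem_sup_range_of_eqOn₂ ℚ ℚ h1o h2o hBo hcov hdisj h hB hhA₁ hhA₂ n y
    obtain ⟨v₁, hv₁, v₂, hv₂, hsum⟩ := Submodule.mem_sup.1 hv
    obtain ⟨a₁, rfl⟩ := hv₁
    obtain ⟨a₂, rfl⟩ := hv₂
    -- apply `q := 1 − τ_*²`: `q (h_* y − y) = 2 (h_* y − y)` and `q (ι_* a_k) = ι_* (a_k − τ|² a_k) ∈ W_k`
    have hq : map ℚ ℚ h n y - y - map ℚ ℚ τ n (map ℚ ℚ τ n (map ℚ ℚ h n y - y)) = (2 : ℚ) • (map ℚ ℚ h n y - y) := by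
      rw [map_sub, map_sub, ← hht, ← hht, hy, map_neg, two_smul]
      abel
    have hmem : map ℚ ℚ h n y - y - map ℚ ℚ τ n (map ℚ ℚ τ n (map ℚ ℚ h n y - y)) ∈ W₁ ⊔ W₂ := by
      rw [← hsum, map_add, map_add]
      have e : (map ℚ ℚ (subsetIncl A₁) n).hom a₁ + (map ℚ ℚ (subsetIncl A₂) n).hom a₂ -
          (map ℚ ℚ τ n (map ℚ ℚ τ n ((map ℚ ℚ (subsetIncl A₁) n).hom a₁)) +
            map ℚ ℚ τ n (map ℚ ℚ τ n ((map ℚ ℚ (subsetIncl A₂) n).hom a₂))) =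
          map ℚ ℚ (subsetIncl A₁) n (a₁ - map ℚ ℚ (restrictSelf τ hτA₁) n (map ℚ ℚ (restrictSelf τ hτA₁) n a₁)) +
          map ℚ ℚ (subsetIncl A₂) n (a₂ - map ℚ ℚ (restrictSelf τ hτA₂) n (map ℚ ℚ (restrictSelf τ hτA₂) n a₂)) := by
        rw [map_sub, map_sub, ← map_map_subsetIncl_restrictSelf τ hτA₁, ← map_map_subsetIncl_restrictSelf τ hτA₁,
          ← map_map_subsetIncl_restrictSelf τ hτA₂, ← map_map_subsetIncl_restrictSelf τ hτA₂]
        change _ = (map ℚ ℚ (subsetIncl A₁) n).hom a₁ - _ + ((map ℚ ℚ (subsetIncl A₂) n).hom a₂ - _)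
        abel
      rw [e]
      exact Submodule.add_mem_sup (hmemW hτA₁ _ (hproj hτA₁ a₁)) (hmemW hτA₂ _ (hproj hτA₂ a₂))
    rw [hq] at hmem
    have h2 : map ℚ ℚ h n y - y = (1 / 2 : ℚ) • ((2 : ℚ) • (map ℚ ℚ h n y - y)) := by
      rw [smul_smul]; norm_num
    rw [h2]
    exact Submodule.smul_mem _ _ hmem
  · -- `h_* = τ_*` on `W₁`
    intro w hw
    obtain ⟨a, ha, rfl⟩ := hrep hτA₁ w hw
    rw [map_map_subsetIncl_of_mapsTo ℚ h hhA₁ n, map_map_subsetIncl_restrictSelf τ hτA₁]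
    exact congrArg _ (hloc₁ a ha)
  · -- `h_* τ_* = 1` on `W₂`
    intro w hw
    obtain ⟨a, ha, rfl⟩ := hrep hτA₂ w hw
    rw [map_map_subsetIncl_restrictSelf τ hτA₂, map_map_subsetIncl_of_mapsTo ℚ h hhA₂ n]
    exact congrArg _ (hloc₂ a ha)
  · -- ranks: `W_k = ι_* (ker(τ|² + 1))`
    have hle : W₁ ≤ (Module.End.eigenspace ((map ℚ ℚ (restrictSelf τ hτA₁) n).hom ^ 2) (-1 : ℚ)).map
        (map ℚ ℚ (subsetIncl A₁) n).hom := fun w hw => by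
      obtain ⟨a, ha, rfl⟩ := hrep hτA₁ w hw
      exact ⟨a, (hmemEA hτA₁ a).2 ha, rfl⟩
    exact (Submodule.finrank_mono hle).trans (Submodule.finrank_map_le _ _)
  · have hle : W₂ ≤ (Module.End.eigenspace ((map ℚ ℚ (restrictSelf τ hτA₂) n).hom ^ 2) (-1 : ℚ)).map
        (map ℚ ℚ (subsetIncl A₂) n).hom := fun w hw => by
      obtain ⟨a, ha, rfl⟩ := hrep hτA₂ w hw
      exact ⟨a, (hmemEA hτA₂ a).2 ha, rfl⟩
    exact (Submodule.finrank_mono hle).trans (Submodule.finrank_map_le _ _)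

end Kernel

end singularHomology

end Literature.AlgebraicTopology.SingularHomology

end
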